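import Literature.Probability.LatticeModels.KramersWannierDuality
import Literature.Barriers.CriticalPhenomena.PositionSpaceRGNonGibbsianThm41
import Literature.Barriers.CriticalPhenomena.PositionSpaceRGNonGibbsianUnfixing
import HarnessLib

/-!
# Israel's example (van Enter–Fernández–Sokal 1993, §4.1.2): the lattice geometry of Steps 2–3

Companion file of `PositionSpaceRGNonGibbsianThm41.lean` (Theorem 4.1 reduced to the finite-volume
estimate (4.13), `VEFS1993_eq413_israel`). This file sets up the explicit `ℤ²` bookkeeping used to prove
(4.13) from Step 2: image sites (both coordinates even), the internal volume
`W'_n = Λ^int_{2n+2}` of Step 2, the REDUCED internal-spin system of Step 2 (Figure 4(c): "a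
system consisting of the spins in `Λ^int_{R+2}`, with a magnetic field `+J` on each spin in layer
`Γ^int_{R+2}`" and no other field) realised as the nearest-neighbour Ising model on the graph
`cutGraph n` — `ℤ²` with every bond at an image site of `Λ_{2n+2}` deleted — with `+` boundary
condition, and the vertex-by-vertex form of the Ising energy on `ℤ²` (anchored bonds of
`KramersWannierDuality`).

## What the source prints (arXiv:hep-lat/9210032, pp. 96–97)

Step 2: "Each internal spin in `Λ^int_{R+2}` feels an 'effective magnetic field' `±J` from each
image spin adjacent to it; but because the image-spin configuration in `Λ_R` is alternating, these
'effective magnetic fields' are all zero except at some sites in layers `Γ_{R+1}` and `Γ_{R+2}`: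
(i) An internal spin in layer `Γ_{R+1}` feels an effective field `+2J` if it is adjacent to two `+`
image spins. (ii) An internal spin in layer `Γ_{R+2}` feels an effective field `+3J` or `+J`
depending on whether the adjacent spin in layer `Γ_{R+3}` (which is always an internal spin)
happens to be `+` or `-`. … by the FKG inequality (or alternatively the Griffiths II
inequality), the local magnetizations … are bounded below by the values that they would take if
the magnetic fields `+2J` in (i) were changed to zero, and the fields `+3J` in (ii) changed to
`+J`. We now have a system consisting of the spins in `Λ^int_{R+2}`, with a magnetic field `+J`
on each spin in layer `Γ^int_{R+2}` [Figure 4(c)]."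

## What is formalised (namespace `Literature.Barriers.CriticalPhenomena.NonGibbs`)

`IsImageSite`, `halve`, `internalVolume n` (`W'_n`), `cutGraph n` and its instances,
`frozenField` (the effective field `∑_{z ∼ y, z ∉ Λ} σ_z` felt by `y` from the spins off `Λ`),
and the vertex forms of the energy: `sum_edgesTouching_bondSpin_eq` (`ℤ²`, via the anchored bonds
of `KramersWannierDuality`) and `sum_edgesTouching_cutGraph_eq` (`cutGraph n`). The admissible
boundary conditions and the sign of the effective fields (Step 2 (i)–(ii)) are in
`PositionSpaceRGNonGibbsianIsraelFields.lean`. All proved; no named facts.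
-/

noncomputable section

namespace Literature.Barriers.CriticalPhenomena.NonGibbs

open Finset Literature.Probability.LatticeModels Literature.Probability.LatticeModels.AEdge

/-! ### Image sites and halving -/

/-- **Image sites** of the `b = 2` decimation on `ℤ²`: "those spins with both coordinates even"
(van Enter–Fernández–Sokal §4.1.2, p. 92). [cite: VanenterFernandezSokal1993, §4.1.2] -/
def IsImageSite (z : Site 2) : Prop := Even (z 0) ∧ Even (z 1)

/-- Being an image site is decidable (parity of two integers). [cite: VanenterFernandezSokal1993, §4.1.2] -/
instance : DecidablePred IsImageSite := fun z =>
  inferInstanceAs (Decidable (Even (z 0) ∧ Even (z 1)))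

/-- Image site = all coordinates even (the phrasing of `israelVolume`).
[cite: VanenterFernandezSokal1993, §4.1.2] -/
theorem isImageSite_iff_forall_even {z : Site 2} : IsImageSite z ↔ ∀ i, Even (z i) := by
  simp [IsImageSite, Fin.forall_fin_two]

/-- Image site = all coordinates divisible by `2` (the phrasing of `gpiVolume'`).
[cite: VanenterFernandezSokal1993, §4.1.2] -/
theorem isImageSite_iff_forall_two_dvd {z : Site 2} : IsImageSite z ↔ ∀ i, (2 : ℤ) ∣ z i := by
  simp [isImageSite_iff_forall_even, even_iff_two_dvd]

/-- Image coordinates of a site: `z ↦ z/2` coordinatewise (inverse of `double` on image sites).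
[cite: VanenterFernandezSokal1993, §3.1.2 eq. (3.7)] -/
def halve (z : Site 2) : Site 2 := fun i => z i / 2

/-- `double x` is an image site. [cite: VanenterFernandezSokal1993, §4.1.2] -/
theorem isImageSite_double (x : Site 2) : IsImageSite (double x) :=
  ⟨even_double_apply x 0, even_double_apply x 1⟩

/-- `halve (double x) = x`. [cite: VanenterFernandezSokal1993, §3.1.2 eq. (3.7)] -/
@[simp] theorem halve_double (x : Site 2) : halve (double x) = x := by
  funext i; simp [halve, double]

/-- `double (halve z) = z` for an image site. [cite: VanenterFernandezSokal1993, §3.1.2 eq. (3.7)] -/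
theorem double_halve {z : Site 2} (hz : IsImageSite z) : double (halve z) = z := by
  funext i
  simp only [double, halve]
  have : Even (z i) := by fin_cases i <;> [exact hz.1; exact hz.2]
  obtain ⟨k, hk⟩ := this
  omega

/-- The origin is an image site. [cite: VanenterFernandezSokal1993, §4.1.2] -/
theorem isImageSite_zero : IsImageSite (0 : Site 2) := ⟨⟨0, rfl⟩, ⟨0, rfl⟩⟩

/-- An image site lies in `Λ_{2L} = box 2 (2L)` iff its image coordinates lie in `box 2 L`.
[cite: VanenterFernandezSokal1993, §4.1.2] -/
theorem mem_box_two_mul_iff_halve {z : Site 2} (hz : IsImageSite z) (L : ℕ) :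
    z ∈ box 2 (2 * L) ↔ halve z ∈ box 2 L := by
  simp only [mem_box, halve, Nat.cast_mul, Nat.cast_ofNat]
  constructor
  · intro h i
    have hi := h i
    have : Even (z i) := by fin_cases i <;> [exact hz.1; exact hz.2]
    obtain ⟨k, hk⟩ := this
    omega
  · intro h i
    have hi := h i
    have : Even (z i) := by fin_cases i <;> [exact hz.1; exact hz.2]
    obtain ⟨k, hk⟩ := this
    omega

/-! ### The internal volume `W'_n = Λ^int_{2n+2}` -/

/-- **The internal sites of `Λ_{2n+2}`**, `W'_n = Λ^int_{R+2}` (`R = 2n`): the volume of the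
internal-spin systems of Step 2 (all image spins frozen). This is the tree's `gpiVolume' 2 (n+1)`
(`PositionSpaceRGNonGibbsianUnfixing.lean`, the internal spins of the cube `Λ_{R'} = box d (2R')`
of the Theorem 4.2 line) at `d = 2`, `R' = n + 1`; the name records its role in Israel's example.
[cite: VanenterFernandezSokal1993, §4.1.2 Step 2] -/
def internalVolume (n : ℕ) : Finset (Site 2) := gpiVolume' 2 (n + 1)

/-- `W'_n` is `gpiVolume' 2 (n+1)`. [cite: VanenterFernandezSokal1993, §4.1.2 Step 2] -/
theorem internalVolume_eq_gpiVolume' (n : ℕ) : internalVolume n = gpiVolume' 2 (n + 1) := rfl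

/-- Membership in `W'_n`: a site of `Λ_{2n+2}` which is not an image site.
[cite: VanenterFernandezSokal1993, §4.1.2 Step 2] -/
theorem mem_internalVolume_iff {n : ℕ} {y : Site 2} :
    y ∈ internalVolume n ↔ y ∈ box 2 (2 * n + 2) ∧ ¬ IsImageSite y := by
  rw [internalVolume, gpiVolume', Finset.mem_filter, isImageSite_iff_forall_two_dvd,
    show 2 * (n + 1) = 2 * n + 2 by ring]

/-- `W_n = {0} ∪ W'_n`: the volume of Step 3 is the internal volume plus the origin.
[cite: VanenterFernandezSokal1993, §4.1.2 Step 3] -/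
theorem israelVolume_eq_insert (n : ℕ) : israelVolume n = insert 0 (internalVolume n) := by
  ext y
  rw [mem_israelVolume_iff, Finset.mem_insert, mem_internalVolume_iff, isImageSite_iff_forall_even]
  constructor
  · rintro ⟨hb, h | h⟩
    · exact Or.inl h
    · exact Or.inr ⟨hb, h⟩
  · rintro (h | ⟨hb, h⟩)
    · exact ⟨h ▸ zero_mem_box 2 _, Or.inl h⟩
    · exact ⟨hb, Or.inr h⟩

/-- The origin is not an internal site (`zero_notMem_gpiVolume'`). [cite: VanenterFernandezSokal1993, §4.1.2] -/
theorem zero_not_mem_internalVolume (n : ℕ) : (0 : Site 2) ∉ internalVolume n :=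
  zero_notMem_gpiVolume' (n + 1)

/-- `W'_n ⊆ W_n`. [cite: VanenterFernandezSokal1993, §4.1.2 Step 3] -/
theorem internalVolume_subset_israelVolume (n : ℕ) : internalVolume n ⊆ israelVolume n := by
  rw [israelVolume_eq_insert]; exact Finset.subset_insert _ _

/-- `W_n ∖ W'_n = {0}`. [cite: VanenterFernandezSokal1993, §4.1.2 Step 3] -/
theorem israelVolume_sdiff_internalVolume (n : ℕ) :
    israelVolume n \ internalVolume n = {0} := by
  rw [israelVolume_eq_insert, Finset.insert_sdiff_of_notMem _ (zero_not_mem_internalVolume n),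
    Finset.sdiff_self, Finset.insert_empty]

/-- `W_n` minus the origin is `W'_n` (the volume `Λ ∖ {a}` of the unfixing identity
`isingExpect_spinAt_eq_unfix`). [cite: VanenterFernandezSokal1993, §4.1.2 Step 3] -/
theorem israelVolume_erase_zero (n : ℕ) : (israelVolume n).erase 0 = internalVolume n := by
  rw [israelVolume_eq_insert, Finset.erase_insert (zero_not_mem_internalVolume n)]

/-- The neighbours of the origin are internal sites (`mem_gpiVolume'_of_adj_zero`): the origin
interacts only with spins of `W'_n`. [cite: VanenterFernandezSokal1993, §4.1.2 Step 3] -/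
theorem mem_internalVolume_of_adj_zero (n : ℕ) {y : Site 2} (hy : (zdGraph 2).Adj 0 y) :
    y ∈ internalVolume n :=
  mem_gpiVolume'_of_adj_zero (by omega) hy

/-- `eᵢ ∈ W'_n`. [cite: VanenterFernandezSokal1993, §4.1.2 Step 3] -/
theorem vec_mem_internalVolume (n : ℕ) (i : Fin 2) : vec i ∈ internalVolume n := by
  refine mem_internalVolume_of_adj_zero n ?_
  have h := AEdge.adj ((0 : Site 2), i)
  simp only [tip, zero_add] at h
  exact h

/-- `-eᵢ ∈ W'_n`. [cite: VanenterFernandezSokal1993, §4.1.2 Step 3] -/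
theorem neg_vec_mem_internalVolume (n : ℕ) (i : Fin 2) : -vec i ∈ internalVolume n := by
  refine mem_internalVolume_of_adj_zero n ?_
  have h := (AEdge.adj ((-vec i : Site 2), i))
  simp only [tip, neg_add_cancel] at h
  exact h.symm

/-! ### The reduced graph: `ℤ²` with the bonds at the image sites of `Λ_{2n+2}` deleted -/

/-- The sites whose bonds are deleted in the reduced system: the image sites of `Λ_{2n+2}` (the
image spins of `Λ_{2n}`, whose effective fields cancel or are lowered to `0` in Step 2 (i), and of
the annulus `Γ_{2n+2}`, whose fields `+2J` on layer `Γ_{2n+2}` are traded, together with the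
outside spin, for the single field `+J` of Step 2 (ii)). [cite: VanenterFernandezSokal1993, §4.1.2 Step 2 (i)–(ii)] -/
def IsCutSite (n : ℕ) (z : Site 2) : Prop := z ∈ box 2 (2 * n + 2) ∧ IsImageSite z

/-- Being a cut site is decidable. [cite: VanenterFernandezSokal1993, §4.1.2 Step 2] -/
instance (n : ℕ) : DecidablePred (IsCutSite n) := fun z =>
  inferInstanceAs (Decidable (z ∈ box 2 (2 * n + 2) ∧ IsImageSite z))

/-- **The reduced graph** `cutGraph n`: the nearest-neighbour graph of `ℤ²` with every bond incident
to an image site of `Λ_{2n+2}` removed. The nearest-neighbour Ising model on it in the volume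
`W'_n` with `+` boundary condition and zero field is the reduced system of Step 2, Figure 4(c):
internal bonds `J`, no field inside, field `+J` on each internal spin of layer `Γ_{2n+2}` (its one
bond leaving `Λ_{2n+2}`, to a frozen `+` spin). [cite: VanenterFernandezSokal1993, §4.1.2 Step 2, Figure 4(c)] -/
def cutGraph (n : ℕ) : SimpleGraph (Site 2) where
  Adj x y := (zdGraph 2).Adj x y ∧ ¬ IsCutSite n x ∧ ¬ IsCutSite n y
  symm := ⟨fun _ _ h => ⟨h.1.symm, h.2.2, h.2.1⟩⟩
  loopless := ⟨fun _ h => h.1.ne rfl⟩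

/-- Adjacency in the reduced graph. [cite: VanenterFernandezSokal1993, §4.1.2 Step 2, Figure 4(c)] -/
theorem cutGraph_adj_iff {n : ℕ} {x y : Site 2} :
    (cutGraph n).Adj x y ↔ (zdGraph 2).Adj x y ∧ ¬ IsCutSite n x ∧ ¬ IsCutSite n y := Iff.rfl

/-- Adjacency in the reduced graph is decidable. [cite: VanenterFernandezSokal1993, §4.1.2 Step 2, Figure 4(c)] -/
instance (n : ℕ) : DecidableRel (cutGraph n).Adj := fun _ _ =>
  inferInstanceAs (Decidable (_ ∧ _ ∧ _))

/-- The reduced graph is locally finite (its neighbourhoods are contained in those of `ℤ²`), so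
the tree's finite-volume Ising model `isingMeasure (cutGraph n)` is available.
[cite: VanenterFernandezSokal1993, §4.1.2 Step 2, Figure 4(c)] -/
instance (n : ℕ) : (cutGraph n).LocallyFinite := fun x =>
  Fintype.ofFinset (((zdGraph 2).neighborFinset x).filter fun y => (cutGraph n).Adj x y) (by
    intro y
    simp only [Finset.mem_filter, SimpleGraph.mem_neighborFinset, SimpleGraph.mem_neighborSet,
      and_iff_right_iff_imp]
    exact fun h => h.1)

/-- Internal sites are never cut. [cite: VanenterFernandezSokal1993, §4.1.2 Step 2] -/
theorem not_isCutSite_of_mem_internalVolume {n : ℕ} {y : Site 2} (hy : y ∈ internalVolume n) :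
    ¬ IsCutSite n y := fun h => (mem_internalVolume_iff.1 hy).2 h.2

/-- A site of `Λ_{2n+2}` off `W'_n` is an image site, hence cut. [cite: VanenterFernandezSokal1993, §4.1.2 Step 2] -/
theorem isCutSite_of_mem_box_of_not_mem {n : ℕ} {z : Site 2} (hz : z ∈ box 2 (2 * n + 2))
    (hz' : z ∉ internalVolume n) : IsCutSite n z := by
  refine ⟨hz, ?_⟩
  by_contra h
  exact hz' (mem_internalVolume_iff.2 ⟨hz, h⟩)

/-! ### Effective fields from frozen spins, and the vertex form of the energy -/

/-- **The effective field felt by `y` from the spins off `P`**: `∑_{z = y ± eᵢ, z ∉ P} g z`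
(Step 2: "Each internal spin … feels an 'effective magnetic field' `±J` from each image spin
adjacent to it"). With `P = (· ∈ Λ)` and `g = σ` this is the field on `y ∈ Λ` exerted by the frozen
spins; with `P = (· ∈ Λ_{2n+2})` and `g = 1` it counts the bonds of `y` leaving the box.
[cite: VanenterFernandezSokal1993, §4.1.2 Step 2] -/
def frozenField (P : Site 2 → Prop) [DecidablePred P] (g : Site 2 → ℝ) (y : Site 2) : ℝ :=
  ∑ i : Fin 2, ((if P (y + vec i) then 0 else g (y + vec i)) +
    (if P (y - vec i) then 0 else g (y - vec i)))

/-- The effective field depends on the frozen-site predicate only through its extension.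
[cite: VanenterFernandezSokal1993, §4.1.2 Step 2] -/
theorem frozenField_congr {P P' : Site 2 → Prop} [DecidablePred P] [DecidablePred P']
    (h : ∀ z, P z ↔ P' z) {g : Site 2 → ℝ} {y : Site 2} :
    frozenField P g y = frozenField P' g y := by
  unfold frozenField
  refine Finset.sum_congr rfl fun i _ => ?_
  rw [if_congr (h _) rfl rfl, if_congr (h _) rfl rfl]

/-- **Vertex form of the Ising energy on `ℤ²`** (fixed boundary condition, bonds `ℰ^b_Λ`): the sum
of `σ_uσ_v` over the bonds meeting `Λ` is the sum over the bonds inside `Λ` plus, for each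
`y ∈ Λ`, `σ_y` times the effective field of the spins off `Λ` adjacent to `y`.
[cite: VanenterFernandezSokal1993, §4.1.2 Step 2] -/
theorem sum_anchT_filter_eq (Λ : Finset (Site 2)) (K : Site 2 → Prop) [DecidablePred K]
    (hK : ∀ y ∈ Λ, K y) (σ : SpinConfig (Site 2)) :
    ∑ ε ∈ (anchT Λ).filter (fun ε => K ε.1 ∧ K ε.tip), bE ε σ =
      ∑ ε ∈ anch Λ, bE ε σ +
        ∑ y ∈ Λ, spinAt y σ *
          frozenField (fun z => z ∈ Λ ∨ ¬ K z) (fun z => spinAt z σ) y := by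
  classical
  -- split the anchored bonds meeting `Λ` according to which endpoints lie in `Λ`
  set T := (anchT Λ).filter (fun ε => K ε.1 ∧ K ε.tip) with hT
  have hsplit : T = anch Λ ∪ (T.filter fun ε => ε.1 ∈ Λ ∧ ε.tip ∉ Λ) ∪
      (T.filter fun ε => ε.1 ∉ Λ ∧ ε.tip ∈ Λ) := by
    ext ε
    simp only [hT, Finset.mem_union, Finset.mem_filter, mem_anchT, mem_anch]
    constructor
    · rintro ⟨h | h, hk⟩
      · by_cases ht : ε.tip ∈ Λ
        · exact Or.inl (Or.inl ⟨h, ht⟩)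
        · exact Or.inl (Or.inr ⟨⟨Or.inl h, hk⟩, h, ht⟩)
      · by_cases h1 : ε.1 ∈ Λ
        · exact Or.inl (Or.inl ⟨h1, h⟩)
        · exact Or.inr ⟨⟨Or.inr h, hk⟩, h1, h⟩
    · rintro ((⟨h1, h2⟩ | ⟨⟨h, hk⟩, -⟩) | ⟨⟨h, hk⟩, -⟩)
      · exact ⟨Or.inl h1, hK _ h1, hK _ h2⟩
      · exact ⟨h, hk⟩
      · exact ⟨h, hk⟩
  have hd1 : Disjoint (anch Λ) (T.filter fun ε => ε.1 ∈ Λ ∧ ε.tip ∉ Λ) := by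
    rw [Finset.disjoint_left]
    intro ε h1 h2
    exact (Finset.mem_filter.1 h2).2.2 (mem_anch.1 h1).2
  have hd2 : Disjoint (anch Λ ∪ T.filter fun ε => ε.1 ∈ Λ ∧ ε.tip ∉ Λ)
      (T.filter fun ε => ε.1 ∉ Λ ∧ ε.tip ∈ Λ) := by
    rw [Finset.disjoint_left]
    intro ε h1 h2
    have h1' : ε.1 ∈ Λ := by
      rcases Finset.mem_union.1 h1 with h | h
      · exact (mem_anch.1 h).1
      · exact (Finset.mem_filter.1 h).2.1
    exact (Finset.mem_filter.1 h2).2.1 h1'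
  rw [hsplit, Finset.sum_union hd2, Finset.sum_union hd1, add_assoc]
  congr 1
  -- the two one-sided sums, re-indexed by the endpoint in `Λ` and the direction
  have hout : ∀ {z : Site 2}, z ∉ Λ → K z → ¬ (z ∈ Λ ∨ ¬ K z) := fun hz hk h =>
    h.elim hz (fun h => h hk)
  have e1 : ∑ ε ∈ T.filter (fun ε => ε.1 ∈ Λ ∧ ε.tip ∉ Λ), bE ε σ =
      ∑ y ∈ Λ, ∑ i : Fin 2, spinAt y σ *
        (if (y + vec i ∈ Λ ∨ ¬ K (y + vec i)) then 0 else spinAt (y + vec i) σ) := by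
    rw [← Finset.sum_product']
    have hset : T.filter (fun ε => ε.1 ∈ Λ ∧ ε.tip ∉ Λ) =
        (Λ ×ˢ (Finset.univ : Finset (Fin 2))).filter
          fun ε => ¬ (ε.1 + vec ε.2 ∈ Λ ∨ ¬ K (ε.1 + vec ε.2)) := by
      ext ⟨y, i⟩
      simp only [hT, Finset.mem_filter, mem_anchT, Finset.mem_product, Finset.mem_univ, and_true,
        tip, not_or, not_not]
      constructor
      · rintro ⟨⟨-, -, hk⟩, hy, ht⟩
        exact ⟨hy, ht, hk⟩
      · rintro ⟨hy, ht, hk⟩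
        exact ⟨⟨Or.inl hy, hK _ hy, hk⟩, hy, ht⟩
    rw [hset, Finset.sum_filter]
    refine Finset.sum_congr rfl fun ε _ => ?_
    by_cases hc : (ε.1 + vec ε.2 ∈ Λ ∨ ¬ K (ε.1 + vec ε.2))
    · rw [if_neg (not_not_intro hc), if_pos hc, mul_zero]
    · rw [if_pos hc, if_neg hc]
      rfl
  have e2 : ∑ ε ∈ T.filter (fun ε => ε.1 ∉ Λ ∧ ε.tip ∈ Λ), bE ε σ =
      ∑ y ∈ Λ, ∑ i : Fin 2, spinAt y σ *
        (if (y - vec i ∈ Λ ∨ ¬ K (y - vec i)) then 0 else spinAt (y - vec i) σ) := by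
    rw [← Finset.sum_product']
    -- re-index by `(y, i) ↦ (y - eᵢ, i)`
    have hset : T.filter (fun ε => ε.1 ∉ Λ ∧ ε.tip ∈ Λ) =
        ((Λ ×ˢ (Finset.univ : Finset (Fin 2))).filter
          fun p => ¬ (p.1 - vec p.2 ∈ Λ ∨ ¬ K (p.1 - vec p.2))).image
            fun p => (p.1 - vec p.2, p.2) := by
      ext ⟨u, i⟩
      simp only [hT, Finset.mem_filter, mem_anchT, Finset.mem_image, Finset.mem_product,
        Finset.mem_univ, and_true, tip, not_or, not_not, Prod.mk.injEq]
      constructor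
      · rintro ⟨⟨-, hk, -⟩, hu, ht⟩
        refine ⟨(u + vec i, i), ⟨ht, ?_, ?_⟩, ?_, rfl⟩
        · simpa using hu
        · simpa using hk
        · simp
      · rintro ⟨⟨y, j⟩, ⟨hy, hn, hk⟩, h1, rfl⟩
        simp only at h1 hy hn hk
        subst h1
        refine ⟨⟨Or.inr (by simpa using hy), hk, ?_⟩, hn, by simpa using hy⟩
        exact hK _ (by simpa using hy)
    rw [hset, Finset.sum_image]
    · rw [Finset.sum_filter]
      refine Finset.sum_congr rfl fun p _ => ?_
      by_cases hc : (p.1 - vec p.2 ∈ Λ ∨ ¬ K (p.1 - vec p.2))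
      · rw [if_neg (not_not_intro hc), if_pos hc, mul_zero]
      · rw [if_pos hc, if_neg hc]
        simp only [bE, tip, sub_add_cancel]
        rw [mul_comm]
    · rintro ⟨y, i⟩ - ⟨y', i'⟩ - h
      simp only [Prod.mk.injEq] at h
      obtain ⟨h1, rfl⟩ := h
      simpa using h1
  rw [e1, e2, ← Finset.sum_add_distrib]
  refine Finset.sum_congr rfl fun y _ => ?_
  rw [frozenField, Finset.mul_sum, ← Finset.sum_add_distrib]
  refine Finset.sum_congr rfl fun i _ => ?_
  ring

/-- **Vertex form of the energy on `ℤ²`**: `∑_{e ∈ ℰ^b_Λ} σ_e = ∑_{e ∈ ℰ_Λ} σ_e + ∑_{y ∈ Λ} σ_y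
· (∑_{z ∼ y, z ∉ Λ} σ_z)`. [cite: VanenterFernandezSokal1993, §4.1.2 Step 2] -/
theorem sum_edgesTouching_bondSpin_eq (Λ : Finset (Site 2)) (σ : SpinConfig (Site 2)) :
    ∑ e ∈ edgesTouching (zdGraph 2) Λ, bondSpin σ e =
      ∑ ε ∈ anch Λ, bE ε σ +
        ∑ y ∈ Λ, spinAt y σ * frozenField (· ∈ Λ) (fun z => spinAt z σ) y := by
  classical
  rw [sum_edgesTouching_eq_sum_anchT]
  simp only [bondSpin_toSym2]
  have h := sum_anchT_filter_eq Λ (fun _ => True) (fun _ _ => trivial) σ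
  rw [Finset.filter_true_of_mem (fun _ _ => ⟨trivial, trivial⟩)] at h
  rw [h]
  congr 1
  refine Finset.sum_congr rfl fun y _ => ?_
  congr 1
  simp only [frozenField, not_true, or_false]

/-- The bonds of the reduced graph meeting `W'_n`, in anchored form: the anchored bonds of `ℤ²`
meeting `W'_n` with no cut endpoint. [cite: VanenterFernandezSokal1993, §4.1.2 Step 2, Figure 4(c)] -/
theorem edgesTouching_cutGraph_eq_image (n : ℕ) :
    edgesTouching (cutGraph n) (internalVolume n) =
      ((anchT (internalVolume n)).filter fun ε => ¬ IsCutSite n ε.1 ∧ ¬ IsCutSite n ε.tip).image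
        toSym2 := by
  classical
  ext e
  rw [mem_edgesTouching_iff, Finset.mem_image]
  constructor
  · rintro ⟨he, x, hx, hxe⟩
    induction e using Sym2.ind with
    | _ a b =>
      have hadj : (cutGraph n).Adj a b := by rwa [SimpleGraph.mem_edgeSet] at he
      obtain ⟨ε, hε⟩ := exists_of_adj hadj.1
      refine ⟨ε, Finset.mem_filter.2 ⟨mem_anchT.2 ?_, ?_⟩, hε⟩
      · rw [← hε, toSym2, Sym2.mem_iff] at hxe
        rcases hxe with rfl | rfl
        · exact Or.inl hx
        · exact Or.inr hx
      · have h1 : ε.1 = a ∨ ε.1 = b := by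
          have : ε.1 ∈ s(a, b) := by rw [← hε, toSym2]; exact Sym2.mem_mk_left _ _
          exact Sym2.mem_iff.1 this
        have h2 : ε.tip = a ∨ ε.tip = b := by
          have : ε.tip ∈ s(a, b) := by rw [← hε, toSym2]; exact Sym2.mem_mk_right _ _
          exact Sym2.mem_iff.1 this
        constructor
        · rcases h1 with h | h <;> rw [h]
          · exact hadj.2.1
          · exact hadj.2.2
        · rcases h2 with h | h <;> rw [h]
          · exact hadj.2.1
          · exact hadj.2.2
  · rintro ⟨ε, hε, rfl⟩
    rw [Finset.mem_filter, mem_anchT] at hε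
    refine ⟨?_, ?_⟩
    · rw [toSym2, SimpleGraph.mem_edgeSet]
      exact ⟨ε.adj, hε.2.1, hε.2.2⟩
    · rcases hε.1 with h | h
      · exact ⟨ε.1, h, Sym2.mem_mk_left _ _⟩
      · exact ⟨ε.tip, h, Sym2.mem_mk_right _ _⟩

/-- **Vertex form of the energy of the reduced system**: the sum of `σ_e` over the bonds of
`cutGraph n` meeting `W'_n` is the sum over the bonds of `ℤ²` inside `W'_n` plus, for each
`y ∈ W'_n`, `σ_y` times the sum of `σ_z` over its neighbours OUTSIDE the box `Λ_{2n+2}` (no field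
from the image spins; Figure 4(c)). [cite: VanenterFernandezSokal1993, §4.1.2 Step 2, Figure 4(c)] -/
theorem sum_edgesTouching_cutGraph_eq (n : ℕ) (σ : SpinConfig (Site 2)) :
    ∑ e ∈ edgesTouching (cutGraph n) (internalVolume n), bondSpin σ e =
      ∑ ε ∈ anch (internalVolume n), bE ε σ +
        ∑ y ∈ internalVolume n, spinAt y σ *
          frozenField (· ∈ box 2 (2 * n + 2)) (fun z => spinAt z σ) y := by
  classical
  rw [edgesTouching_cutGraph_eq_image, Finset.sum_image fun ε _ ε' _ h => toSym2_injective h]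
  simp only [bondSpin_toSym2]
  rw [sum_anchT_filter_eq (internalVolume n) (fun z => ¬ IsCutSite n z)
    (fun y hy => not_isCutSite_of_mem_internalVolume hy) σ]
  -- off `W'_n`, "not cut" means "outside the box"
  have key : ∀ z : Site 2, (z ∈ internalVolume n ∨ ¬¬ IsCutSite n z) ↔ z ∈ box 2 (2 * n + 2) := by
    intro z
    rw [not_not]
    constructor
    · rintro (h | h)
      · exact (mem_internalVolume_iff.1 h).1
      · exact h.1
    · intro hz
      by_cases h : z ∈ internalVolume n
      · exact Or.inl h
      · exact Or.inr (isCutSite_of_mem_box_of_not_mem hz h)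
  refine congrArg₂ (· + ·) rfl (Finset.sum_congr rfl fun y _ => ?_)
  rw [frozenField_congr key]

end Literature.Barriers.CriticalPhenomena.NonGibbs

end
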